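import Summits.ValiantsHypothesis.ValiantsHypothesis.Theses.DivisionGap
import Summits.ValiantsHypothesis.ValiantsHypothesis.Theorems.DivisionGapZeroOneTransferStubZotOfUniform

/-!
# Crux `DivisionGap.ZeroOneTransfer` (stmt-ValiantsHypothesis-5066), line `charged-uncharged` —
registered stub `mmOfUniform` (twin of the skeleton stub `stub_mmOfUniform`): THE UNIFORM FORM OF
THE UNCHARGED CHILD `MonotoneMultiples` IMPLIES `MonotoneMultiples` (bookkeeping)

**Claim settled** (stub C5 of the lead's skeleton, TRUE): the UNIFORM form of the uncharged child
MM of the crux — for every exponent `e` ONE constant `c` such that every 0/1 polynomial `f` over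
`ℝ≥0` in a finite variable type of size `≤ n^e + e`, of total degree `≤ n^e + e` and of
`ℂ`-complexity `≤ n^e + e`, has a nonzero `h` with `L₊(f·h) ≤ 2^((log₂ n + c)^c)` (the cofactor
`h` is NOT charged) — implies MM itself: every 0/1-coefficient family over `ℝ≥0` whose
complexification is a `VP_ℂ` family has a constant `c` and, at every level `n`, a nonzero `h` with
`L₊(f_n·h) ≤ 2^((log₂ n + c)^c)`.

Proof (verbatim the bookkeeping of stub C1, `stub_zotOfUniform`, without the `L₊(h)` term).
Unfold `IsVPFamily = IsPFamily ∧ IsPComputable` (Bürgisser 2000, Defs. 2.2–2.4): a 0/1 `VP_ℂ`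
family comes with three p-bounds `n ^ cᵢ + cᵢ` — on the number of variables, on the total degree
of the complexified polynomial, and on its complexity.  One exponent `e = max c₁ (max c₂ c₃)`
dominates all three (`pow_add_self_le_pow_add_self : a ≤ b → n ^ a + a ≤ n ^ b + b`, also at
`n = 0`), the total degree is unchanged by the injective coefficient map `ℝ≥0 → ℝ → ℂ` (equal
supports, `MvPolynomial.support_map_of_injective`), and the uniform constant for `e` serves every
level `n`.

Unconditional (axioms `propext`, `Classical.choice`, `Quot.sound`). References: [Burgisser2000]
Defs. 2.1–2.4 (the classes); the statement is folklore bookkeeping.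
-/

set_option linter.dupNamespace false

namespace Summit.ValiantsHypothesis.ValiantsHypothesis.Theorems.DivisionGapZeroOneTransfer

open MvPolynomial Literature.Computability.AlgebraicComplexity
open Summit.ValiantsHypothesis.ValiantsHypothesis.Theses.DivisionGap

/-- **Stub C5 — the uniform form of `MonotoneMultiples` implies `MonotoneMultiples`**
(bookkeeping, as Stub C1 `stub_zotOfUniform` without the `L₊(h)` term).  The uniform form: for
every exponent `e` ONE constant `c` such that every 0/1 polynomial `f` over `ℝ≥0` in a finite
variable type of size `≤ n^e + e`, of total degree `≤ n^e + e` and of `ℂ`-complexity `≤ n^e + e`,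
has a nonzero `h` with `L₊(f·h) ≤ 2^((log₂ n + c)^c)`.  Given a 0/1 `VP_ℂ` family, one exponent
`e` dominates the three p-bounds of `IsVPFamily` (`n^a + a ≤ n^e + e` for `a ≤ e`, also at
`n = 0`), the total degree of `f n` equals that of its complexification (the coefficient map
`ℝ≥0 → ℝ → ℂ` is injective, so the support is preserved), and the uniform constant for `e` serves
every level `n`. [folklore] -/
theorem mmOfUniform :
    (∀ e : ℕ, ∃ c : ℕ, ∀ (n : ℕ) (τ : Type) [Fintype τ] (f : MvPolynomial τ NNReal),
      (∀ m, MvPolynomial.coeff m f = 0 ∨ MvPolynomial.coeff m f = 1) →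
      Fintype.card τ ≤ n ^ e + e → f.totalDegree ≤ n ^ e + e →
      Literature.Computability.AlgebraicComplexity.complexity
        (MvPolynomial.map (Complex.ofRealHom.comp NNReal.toRealHom) f) ≤ n ^ e + e →
      ∃ h : MvPolynomial τ NNReal, h ≠ 0 ∧
        Literature.Computability.AlgebraicComplexity.complexity (f * h) ≤
          2 ^ ((Nat.log 2 n + c) ^ c)) →
    (∀ (σ : ℕ → Type) [∀ n, Fintype (σ n)] (f : ∀ n, MvPolynomial (σ n) NNReal),
      (∀ n m, MvPolynomial.coeff m (f n) = 0 ∨ MvPolynomial.coeff m (f n) = 1) →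
      Literature.Computability.AlgebraicComplexity.IsVPFamily
        (fun n => MvPolynomial.map (Complex.ofRealHom.comp NNReal.toRealHom) (f n)) →
      ∃ c : ℕ, ∀ n, ∃ h : MvPolynomial (σ n) NNReal, h ≠ 0 ∧
        Literature.Computability.AlgebraicComplexity.complexity (f n * h) ≤
          2 ^ ((Nat.log 2 n + c) ^ c)) := by
  intro hU σ _ f h01 hVP
  obtain ⟨⟨⟨c₁, hc₁⟩, ⟨c₂, hc₂⟩⟩, ⟨c₃, hc₃⟩⟩ := hVP
  obtain ⟨c, hc⟩ := hU (max c₁ (max c₂ c₃))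
  -- the complexification of coefficients `ℝ≥0 → ℝ → ℂ` is injective, so supports (hence total
  -- degrees) are preserved
  have hinj : Function.Injective (Complex.ofRealHom.comp NNReal.toRealHom) := fun a b hab => by
    have hab' : ((a : ℝ) : ℂ) = ((b : ℝ) : ℂ) := hab
    exact_mod_cast hab'
  have hdeg : ∀ n, (f n).totalDegree =
      (MvPolynomial.map (Complex.ofRealHom.comp NNReal.toRealHom) (f n)).totalDegree := fun n => by
    rw [MvPolynomial.totalDegree, MvPolynomial.totalDegree,
      MvPolynomial.support_map_of_injective _ hinj]
  refine ⟨c, fun n => hc n (σ n) (f n) (h01 n) ?_ ?_ ?_⟩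
  · exact (hc₁ n).trans (pow_add_self_le_pow_add_self (le_max_left _ _))
  · calc (f n).totalDegree
        = (MvPolynomial.map (Complex.ofRealHom.comp NNReal.toRealHom) (f n)).totalDegree := hdeg n
      _ ≤ n ^ c₂ + c₂ := hc₂ n
      _ ≤ _ := pow_add_self_le_pow_add_self ((le_max_left _ _).trans (le_max_right _ _))
  · exact (hc₃ n).trans
      (pow_add_self_le_pow_add_self ((le_max_right _ _).trans (le_max_right _ _)))

end Summit.ValiantsHypothesis.ValiantsHypothesis.Theorems.DivisionGapZeroOneTransfer
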